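import Literature.Barriers.QuantumAdvantage.PPolyOraclesPPoly
import Literature.Computability.Cryptography.PRPSwitchingLemma
import Literature.Computability.Complexity.OracleCompositionMachine
import Literature.Computability.Complexity.OracleQueryMap
import Literature.Computability.Complexity.TruthTableFunctions
import Literature.Computability.Complexity.HashBricks
import Literature.Computability.Complexity.SplitOnesBricks
import HarnessLib

/-!
# Aaronson–Chen 2017, Thm. 7.6: a `BPP^O` description probing one level is a PPT adversary in the PRF game — the compilation leaf, proved

Sibling proof file of `Literature/Barriers/QuantumAdvantage/PPolyOraclesThm76.lean`; it DISCHARGES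
the leaf `acLang_bppCompiles` of that file (`acLang_bppCompiles_holds`; the step "let `M` be a `BPP`
machine … [it cannot] distinguish `PRP^raw` and `PRF^mod`" of the printed proof of Thm. 7.6,
S. Aaronson, L. Chen, CCC 2017, arXiv:1612.05903, p. 30, in the tree's models): for a
polynomial-time `P^O` machine `M` with bound `q`, coin polynomial `p` and a background `W` that is
the identity outside a finite set `S` of levels, ONE probabilistic polynomial-time oracle adversary
reproduces, for every level `n` and table `g`, the acceptance probability of `(M, q, p)` at `1ⁿ`
relative to `acLang (W[n ↦ g])`, given oracle access to `g`. With the switching lemma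
(`PRPSwitchingLemma.lean`) and the `P/poly` leaf (`PPolyOraclesPPoly.lean`) this leaves TWO leaves
under `aaronsonChen2017_thm76_of_prp`: `aaronsonChen2017_lem75_prfMod_isPRF` and
`aaronsonChen2017_lem75_quantum` (`aaronsonChen2017_thm76_of_prp_of_leaves₂`,
`aaronsonChen2017_thm76_of_leaves₂`).

No Turing machine is programmed; the adversary is assembled from the tree's oracle-machine
combinators: `OracleAlg.mapQuery` (announce `⟨1ⁿ, ⟨1^{q|z|}, s⟩⟩` with each query `s`) and
`OracleAlg.clock` (`OracleQueryMap.lean`), the one-query truth-table transducer `ttFnAlg`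
(`TruthTableFunctions.lean`) answering such an announced query from ONE query `x` to the table
(`s = 1^m 0 1^j 0 x`), and the composite machine `OracleComposition.compose` with its proved
polynomial-time bound `OracleAlg.isPolyTime_compose_holds` (`OracleCompositionMachine.lean`), here
in a form UNIFORM in the oracle (`exists_compose_uniform`, the bookkeeping of
`OracleAlg.exists_polyTime_of_mem_FPRel` with the oracle quantified after the machine).

**What this file adds.** Generic: `run_clock_eq` (the clocked algorithm's output),
`run_ttFnAlg_one` (one announced query against an arbitrary oracle), `queriesAux_mapQuery_lt`
(round index bounded by the fuel), `length_listBool_trans_ofLanguage`, `mem_FP_of_eqOn_compl_finset`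
(finite patches of `FP` functions), `exists_compose_uniform`. Specific (`ACCompile`): the query
rewriting `dF` (`⟨1ⁿ, ⟨1^{q|z|}, s⟩⟩`), the hardwired tables `tblFn` (`tblFn_mem_FP`), the output map
`outU` of the transducer with its semantics `outU_announced` (= the truncated-oracle bit
`Oracle.ofLanguage (truncLang (acLang (W[n ↦ g])) B) s`), `transN`/`fN`/`transN_computes`,
`annM = (M.mapQuery (dF q)).clock q false` with `mapAgree_fN`, `run_annM` (output `gOut`,
`gOut_eq_true_iff : gOut = 1 ↔ z ∈ baseLang`), the query-length bound `length_query_annM` and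
`annM_runs`; the assembly `acLang_bppCompiles_holds`.

## References

* [AaronsonChen2017] arXiv:1612.05903, Thm. 7.6 (proof, p. 30).
* [AroraBarak2009] S. Arora, B. Barak, *Computational Complexity* (2009), §3.4 (oracle machines),
  Def. 7.3 (`BPP` via coin strings), §1.3–1.4 (composition, clocks).
* [LadnerLynchSelman1975] R. Ladner, N. Lynch, A. Selman, TCS 1 (1975), §2–3 (composition of
  polynomial-time oracle machines; truth-table machines).
-/

noncomputable section

namespace Literature.Barriers.QuantumAdvantage

namespace ACCompile

open _root_.Computability Literature.Computability.Complexity Literature.Computability.Cryptography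
open Literature.Computability.Complexity.OracleAlg Polynomial

variable {β : Type}

/-! ### The clocked algorithm's output -/

/-- If `M` produces no output within the clock, the clocked algorithm outputs the default at the
next round. [cite: AroraBarak2009, §3.4] -/
theorem runAux_clock_of_none (M : OracleAlg β) (q : Polynomial ℕ) (b₀ : β) (O : Oracle) (x : List Bool) :
    ∀ (n : ℕ) (as : List (List Bool)), as.length + n = q.eval x.length →
      M.runAux O x n as = none → (M.clock q b₀).runAux O x (n + 1) as = some b₀
  | 0, as, h, _ => by
    rw [runAux_succ, clock_step, if_neg (by omega)]
  | n + 1, as, h, hnone => by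
    rw [runAux_succ, clock_step, if_pos (by omega)]
    rw [runAux_succ] at hnone
    cases hs : M.step x as with
    | inr b => rw [hs] at hnone; exact absurd hnone (by simp)
    | inl y =>
      rw [hs] at hnone
      exact runAux_clock_of_none M q b₀ O x n (as ++ [O y]) (by simp; omega) hnone

/-- **The output of the clocked algorithm**: within `q(|x|) + 1` rounds, `M.clock q b₀` outputs the
output of `M` within `q(|x|)` rounds if there is one, and `b₀` otherwise.
[cite: AroraBarak2009, §3.4] -/
theorem run_clock_eq (M : OracleAlg β) (q : Polynomial ℕ) (b₀ : β) (O : Oracle) (x : List Bool) :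
    (M.clock q b₀).run O (q.eval x.length + 1) x = some ((M.run O (q.eval x.length) x).getD b₀) := by
  cases h : M.run O (q.eval x.length) x with
  | some b => exact run_clock_of_run M q b₀ O x h (Nat.le_succ _)
  | none => exact runAux_clock_of_none M q b₀ O x _ [] (by simp) h

/-! ### The one-query truth-table transducer against an arbitrary oracle -/

/-- **One announced query**: `ttFnAlg Q 1 G` asks `Q ⟨u, ε⟩`, then outputs `G ⟨u, answer⟩` — run
and transcript against every oracle (the tree's `run_ttFnAlg` is stated for language oracles).
[cite: LadnerLynchSelman1975, §3] -/
theorem run_ttFnAlg_one (Q G : List Bool → List Bool) (O : Oracle) (u : List Bool) {k : ℕ} (hk : 2 ≤ k) :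
    (ttFnAlg Q 1 G).run O k u = some (G (boolPair u (O (Q (boolPair u []))))) ∧
      (ttFnAlg Q 1 G).queries O k u = [Q (boolPair u [])] := by
  have hstep0 : (ttFnAlg Q 1 G).step u [] = Sum.inl (Q (boolPair u [])) := by
    rw [ttFnAlg_step_of_lt u (by simp)]; rfl
  have hstep1 : ∀ a : List Bool, (ttFnAlg Q 1 G).step u [a] = Sum.inr (G (boolPair u a)) := by
    intro a
    rw [ttFnAlg_step_of_le u (by simp)]
    simp
  have h := (ttFnAlg Q 1 G).runAux_of_trace O u [Q (boolPair u [])] [] (G (boolPair u (O (Q (boolPair u [])))))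
    k (fun i hi => by
      simp only [List.length_singleton, Nat.lt_one_iff] at hi
      subst hi
      simpa using hstep0) (by simpa using hstep1 _) (by simp; omega)
  exact h

/-! ### Composition of polynomial-time oracle algorithms, uniformly in the oracle -/

/-- **The composite machine, uniformly in the oracle** (the bookkeeping of
`OracleAlg.exists_polyTime_of_mem_FPRel` with the oracle `O`, the intermediate function `f` and
the computed function `g` quantified AFTER the machine): for polynomial-time `M`, `N` and
polynomials `qM`, `qN` there are a polynomial-time oracle algorithm `C` — the composite
`OracleComposition.compose M N eb prm` — and a polynomial `K` such that, for every oracle `O` and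
every `f` that `N` computes relative to `O` within `qN` rounds with short queries, and every
input `x` on which `M` with the intermediate oracle `f` outputs `g x` within `qM |x|` rounds with
queries of length `≤ qM |x|`, the composite with oracle `O` outputs `g x` within `K |x|` rounds
with queries of length `≤ K |x|`. [cite: LadnerLynchSelman1975, §2] [cite: AroraBarak2009, §3.4] -/
theorem exists_compose_uniform {eb : Encoding β Bool} {M : OracleAlg β} (hM : M.IsPolyTime eb)
    {N : OracleAlg (List Bool)} (hN : N.IsPolyTime (encodingList Bool)) (qM qN : Polynomial ℕ) :
    ∃ C : OracleAlg β, C.IsPolyTime eb ∧ ∃ K : Polynomial ℕ,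
      ∀ (O f : Oracle) (g : List Bool → β),
        (∀ u, N.run O (qN.eval u.length) u = some (f u) ∧
          ∀ y ∈ N.queries O (qN.eval u.length) u, y.length ≤ qN.eval u.length) →
        ∀ x, (M.run f (qM.eval x.length) x = some (g x) ∧
            ∀ y ∈ M.queries f (qM.eval x.length) x, y.length ≤ qM.eval x.length) →
          C.run O (K.eval x.length) x = some (g x) ∧
            ∀ y ∈ C.queries O (K.eval x.length) x, y.length ≤ K.eval x.length := by
  classical
  obtain ⟨RM, hRM⟩ := hM.exists_length_le
  obtain ⟨RN, hRN⟩ := hN.exists_length_le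
  -- the bounding polynomials (in the input length `n ≥ |x|` of the composite step function)
  let Kq : Polynomial ℕ := qN.comp qM
  let E : Polynomial ℕ := 2 * qM + 2 + Polynomial.X
  let F : Polynomial ℕ := RN.comp E
  let Lb : Polynomial ℕ := 2 * qM + 2 + qM * (2 * F + 2)
  let B : Polynomial ℕ := RM.comp (2 * Polynomial.X + 2 + Lb)
  let Pd : Polynomial ℕ := qM * (Kq + 2) + 1
  let P : Polynomial ℕ := qM + Kq + F + B + Pd
  obtain ⟨prm, hprm, hC⟩ := isPolyTime_compose_holds β eb M N hM hN P
  refine ⟨OracleComposition.compose M N eb prm, hC, qM * Kq + Kq + 1, fun O f g hNrun x hMrun => ?_⟩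
  set m := x.length with hm
  -- the trace of `M` with oracle `f` on `x`
  obtain ⟨us, huslen, hstep, hout, hus⟩ :=
    M.exists_trace_of_runAux f x (qM.eval m) [] (g x) hMrun.1
  simp only [List.nil_append] at hstep hout
  have hub : ∀ u ∈ us, u.length ≤ qM.eval m := fun u hu =>
    hMrun.2 u (by rw [OracleAlg.queries, hus]; exact hu)
  -- `N` computes `f` on every query of `M`, within `kN` rounds
  set kN := Kq.eval m with hkN
  have hkN' : ∀ u ∈ us, qN.eval u.length ≤ kN := fun u hu => by
    rw [hkN]; simpa [Kq] using TM2Iter.eval_mono qN (hub u hu)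
  have hNrun' : ∀ u ∈ us, N.run O kN u = some (f u) := fun u hu =>
    N.run_mono O u (hkN' u hu) (hNrun u).1
  have hNq : ∀ u ∈ us, ∀ q ∈ N.queries O kN u, q.length ≤ kN := fun u hu q hq => by
    have heq : N.queries O kN u = N.queries O (qN.eval u.length) u :=
      N.queriesAux_eq_of_runAux_eq_some O u (hkN' u hu) (hNrun u).1
    rw [heq] at hq
    exact ((hNrun u).2 q hq).trans (hkN' u hu)
  have hvlen : ∀ u ∈ us, (N.queries O kN u).length < kN := fun u hu => by
    obtain ⟨ws, hw, -, -, hws⟩ := N.exists_trace_of_runAux O u kN [] (f u) (hNrun' u hu)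
    rw [OracleAlg.queries, hws]; exact hw
  -- size of the global query sequence
  have hQlen : (us.flatMap fun u => N.queries O kN u).length ≤ qM.eval m * kN := by
    rw [List.length_flatMap]
    exact (OracleComposition.sum_map_le_length_mul us _ kN fun u hu => (hvlen u hu).le).trans
      (Nat.mul_le_mul_right _ huslen.le)
  have hK : (us.flatMap fun u => N.queries O kN u).length < (qM * Kq + Kq + 1).eval m := by
    simp only [Polynomial.eval_add, Polynomial.eval_mul, Polynomial.eval_one, ← hkN]
    nlinarith [hQlen]
  -- the run of the composite machine
  have hrun := OracleComposition.compose_runAux_eq (eb := eb) O f kN prm x (g x) us hstep hout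
    hNrun' ?_ hK
  · refine ⟨hrun.1, fun y hy => ?_⟩
    rw [OracleAlg.queries, hrun.2, List.mem_flatMap] at hy
    obtain ⟨u, hu, hy⟩ := hy
    have := hNq u hu y hy
    simp only [Polynomial.eval_add, Polynomial.eval_mul, Polynomial.eval_one, ← hkN]
    nlinarith
  -- the resource parameters suffice at every stage `j`
  intro j hj n hn
  have hmn : m ≤ n := by rw [hn, OracleComposition.inputLength_eq]; omega
  have hansn : ((encodingList Bool).listBool.encode
      (((us.flatMap fun u => N.queries O kN u).take j).map O)).length ≤ n := by
    rw [hn, OracleComposition.inputLength_eq]; omega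
  have hPb : P.eval n ≤ prm.bndOf n := (hprm n).1
  have hPeval : P.eval n = qM.eval n + Kq.eval n + F.eval n + B.eval n + Pd.eval n := by
    simp [P]
  have hA : qM.eval m ≤ qM.eval n := TM2Iter.eval_mono qM hmn
  have hKq : kN ≤ Kq.eval n := by rw [hkN]; exact TM2Iter.eval_mono Kq hmn
  -- (3) answers of `f` to completed queries
  have hfb : ∀ (i : ℕ) (hi : i < us.length),
      ((us.take (i + 1)).map fun u => (N.queries O kN u).length).sum ≤ j →
        (f (us[i])).length + 1 ≤ F.eval n := by
    intro i hi hsum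
    set u := us[i] with hu_def
    have hu : u ∈ us := List.getElem_mem hi
    obtain ⟨ws, -, -, hwo, hws⟩ := N.exists_trace_of_runAux O u kN [] (f u) (hNrun' u hu)
    simp only [List.nil_append] at hwo
    have hws' : N.queries O kN u = ws := hws
    have hsub : (ws.map O).Sublist (((us.flatMap fun u => N.queries O kN u).take j).map O) := by
      rw [← hws']
      exact (OracleComposition.sublist_take_flatMap us (fun u => N.queries O kN u) i j hi hsum).map O
    have h1 := hRN u (ws.map O)
    rw [hwo] at h1
    have h2 : (boolPair u ((encodingList Bool).listBool.encode (ws.map O))).length ≤ E.eval n := by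
      rw [length_boolPair]
      have := OracleComposition.length_listBool_encode_le_of_sublist hsub
      have := hub u hu
      have hA' : qM.eval m ≤ qM.eval n := TM2Iter.eval_mono qM hmn
      simp only [E, Polynomial.eval_add, Polynomial.eval_mul, Polynomial.eval_ofNat,
        Polynomial.eval_X]
      omega
    have h3 : RN.eval (boolPair u ((encodingList Bool).listBool.encode (ws.map O))).length ≤
        F.eval n := by
      simp only [F, Polynomial.eval_comp]
      exact TM2Iter.eval_mono RN h2
    have h4 : (((encodingList Bool).sumBool (encodingList Bool)).encode
        (Sum.inr (f u) : List Bool ⊕ List Bool)).length = (f u).length + 1 := by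
      simp [Encoding.sumBool, encodingList]
    omega
  refine ⟨fun u hu => (hub u hu).trans (hA.trans (by omega)),
    fun u hu q hq => (hNq u hu q hq).trans (hKq.trans (by omega)),
    fun i hi hsum => by have := hfb i hi hsum; omega, fun hsum => ?_, ?_, ?_⟩
  · -- (4) the output of `M`
    have hall : ∀ (i : ℕ) (hi : i < us.length), (f (us[i])).length + 1 ≤ F.eval n := by
      intro i hi
      refine hfb i hi ((List.Sublist.sum_le_sum ?_ (fun _ _ => Nat.zero_le _)).trans hsum)
      exact (List.take_sublist _ _).map _
    have hLb : ((encodingList Bool).listBool.encode (us.map f)).length ≤ Lb.eval n := by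
      rw [OracleComposition.length_listBool_encode, List.length_map, List.map_map]
      have hs : (us.map ((fun a : List Bool => 2 * a.length + 2) ∘ f)).sum ≤
          us.length * (2 * F.eval n + 2) := by
        refine OracleComposition.sum_map_le_length_mul us _ _ fun u hu => ?_
        obtain ⟨i, hi, rfl⟩ := List.getElem_of_mem hu
        have := hall i hi
        simp only [Function.comp_apply]
        omega
      have hl : us.length * (2 * F.eval n + 2) ≤ qM.eval n * (2 * F.eval n + 2) :=
        Nat.mul_le_mul_right _ (huslen.le.trans hA)
      simp only [Lb, Polynomial.eval_add, Polynomial.eval_mul, Polynomial.eval_ofNat]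
      omega
    have h1 := hRM x (us.map f)
    rw [hout] at h1
    have h2 : (boolPair x ((encodingList Bool).listBool.encode (us.map f))).length ≤
        (2 * Polynomial.X + 2 + Lb).eval n := by
      rw [length_boolPair]
      simp only [Polynomial.eval_add, Polynomial.eval_mul, Polynomial.eval_ofNat, Polynomial.eval_X]
      omega
    have h3 := TM2Iter.eval_mono RM h2
    have h4 : (((encodingList Bool).sumBool eb).encode (Sum.inr (g x) : List Bool ⊕ β)).length =
        (eb.encode (g x)).length + 1 := by
      simp [Encoding.sumBool]
    have hB : B.eval n = RM.eval ((2 * Polynomial.X + 2 + Lb).eval n) := by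
      simp only [B, Polynomial.eval_comp]
    omega
  · -- (5) fuel
    have h1 : (us.map fun u => (N.queries O kN u).length + 2).sum ≤ us.length * (kN + 2) :=
      OracleComposition.sum_map_le_length_mul us _ _ fun u hu => by have := hvlen u hu; omega
    have h2 : us.length * (kN + 2) ≤ qM.eval n * (Kq.eval n + 2) :=
      Nat.mul_le_mul (huslen.le.trans hA) (by omega)
    have h3 : Pd.eval n ≤ prm.padOf n := by
      have := (hprm n).2.1; rw [hPeval] at this; omega
    simp only [Pd, Polynomial.eval_add, Polynomial.eval_mul, Polynomial.eval_ofNat,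
      Polynomial.eval_one] at h3
    omega
  · -- (6) micro-steps
    have h1 : (us.map fun u => (N.queries O kN u).length + 1).sum ≤ us.length * (kN + 2) :=
      OracleComposition.sum_map_le_length_mul us _ _ fun u hu => by have := hvlen u hu; omega
    have h2 : us.length * (kN + 2) ≤ qM.eval n * (Kq.eval n + 2) :=
      Nat.mul_le_mul (huslen.le.trans hA) (by omega)
    have h3 : Pd.eval n ≤ prm.iterOf n := by
      have := (hprm n).2.2; rw [hPeval] at this; omega
    simp only [Pd, Polynomial.eval_add, Polynomial.eval_mul, Polynomial.eval_ofNat,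
      Polynomial.eval_one] at h3
    omega

/-! ### Queries of `M.mapQuery d`, with the round index bounded by the fuel -/

/-- `queriesAux_mapQuery` with the round index bounded: a query asked with fuel `n` from round `j`
comes from a round `i < j + n`. [cite: AroraBarak2009, §3.4] -/
theorem queriesAux_mapQuery_lt (M : OracleAlg β) (d : List Bool → List Bool) (O O₀ : Oracle) (x : List Bool)
    (hagree : MapAgree M d O O₀ x) :
    ∀ (n j : ℕ) (z : List Bool), (∀ i' < j, ∃ y, M.step x (PRelSigma.trans M O₀ x i') = Sum.inl y) →
      z ∈ (M.mapQuery d).queriesAux O x n (PRelSigma.trans M O₀ x j) →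
      ∃ i q, i < j + n ∧ M.step x (PRelSigma.trans M O₀ x i) = Sum.inl q ∧
        z = d (boolPair x (boolPair ((encodingList Bool).listBool.encode (PRelSigma.trans M O₀ x i)) q))
  | 0, _, z, _, hz => by simp at hz
  | n + 1, j, z, hj, hz => by
    unfold queriesAux at hz
    rw [mapQuery_step] at hz
    cases hs : M.step x (PRelSigma.trans M O₀ x j) with
    | inr b => rw [hs] at hz; simp at hz
    | inl q =>
      rw [hs] at hz
      dsimp only at hz
      have htr : PRelSigma.trans M O₀ x j ++ [O₀ q] = PRelSigma.trans M O₀ x (j + 1) := by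
        rw [PRelSigma.trans_succ, PRelSigma.qryOf_eq_of_step_eq hs]
      have hj' : ∀ i' < j + 1, ∃ y, M.step x (PRelSigma.trans M O₀ x i') = Sum.inl y := fun i' hi' => by
        rcases Nat.lt_succ_iff_lt_or_eq.1 hi' with h | rfl
        · exact hj i' h
        · exact ⟨q, hs⟩
      rcases List.mem_cons.1 hz with rfl | hz'
      · exact ⟨j, q, by omega, hs, rfl⟩
      · rw [hagree j q hj hs, htr] at hz'
        obtain ⟨i, q', hi, hsi, rfl⟩ := queriesAux_mapQuery_lt M d O O₀ x hagree n (j + 1) z hj' hz'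
        exact ⟨i, q', by omega, hsi, rfl⟩

/-- The free-running transcript of `M` against a LANGUAGE oracle has `i` one-symbol answers after
`i` rounds, so its `listBool` code has length `6i + 2`. [folklore] -/
theorem length_listBool_trans_ofLanguage (M : OracleAlg β) (A : Language Bool) (x : List Bool) :
    ∀ i : ℕ, ((encodingList Bool).listBool.encode (PRelSigma.trans M (Oracle.ofLanguage A) x i)).length = 6 * i + 2
  | 0 => by simp [OracleComposition.length_listBool_encode]
  | i + 1 => by
    have ih := length_listBool_trans_ofLanguage M A x i
    rw [OracleComposition.length_listBool_encode] at ih ⊢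
    rw [PRelSigma.trans_succ, List.length_append, List.map_append, List.sum_append]
    simp only [List.map_cons, List.map_nil, List.sum_cons, List.sum_nil,
      PRelSigma.ofLanguage_eq_singleton, List.length_cons, List.length_nil]
    omega

/-! ### Finite patches of polynomial-time string functions -/

/-- Patching a string function at one point stays in `FP`. [folklore] -/
theorem update_mem_FP {f : List Bool → List Bool} (hf : f ∈ FP) (a v : List Bool) :
    Function.update f a v ∈ FP := by
  have h : Function.update f a v = iteFn (eqPairFn ∘ fanoutFn id (fun _ => a)) (fun _ => v) f := by
    funext x
    rw [iteFn_apply (b := decide (x = a)) (by simp [fanoutFn_apply, eqPairFn_boolPair])]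
    by_cases hx : x = a
    · subst hx; simp
    · rw [Function.update_of_ne hx]; simp [hx]
  rw [h]
  exact iteFn_mem_FP (comp_mem_FP eqPairFn_mem_FP (fanoutFn_mem_FP OracleCompose.id_mem_FP (const_mem_FP _)))
    (const_mem_FP _) hf

/-- **A function that agrees with a polynomial-time function outside a finite set is
polynomial-time** (one equality test per exceptional point). [folklore] -/
theorem mem_FP_of_eqOn_compl_finset {h₀ : List Bool → List Bool} (h₀FP : h₀ ∈ FP) (D : Finset (List Bool)) :
    ∀ h : List Bool → List Bool, (∀ x, x ∉ D → h x = h₀ x) → h ∈ FP := by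
  classical
  induction D using Finset.induction with
  | empty =>
    intro h hh
    have : h = h₀ := funext fun x => hh x (Finset.notMem_empty _)
    rw [this]; exact h₀FP
  | insert a D ha ih =>
    intro h hh
    have hsupp : ∀ x, x ∉ D → Function.update h a (h₀ a) x = h₀ x := by
      intro x hx
      by_cases hxa : x = a
      · subst hxa; simp
      · rw [Function.update_of_ne hxa]
        exact hh x (by simp [hxa, hx])
    have h' := ih _ hsupp
    have heq : h = Function.update (Function.update h a (h₀ a)) a (h a) := by
      funext x
      by_cases hxa : x = a
      · subst hxa; simp
      · simp [Function.update_of_ne hxa]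
    rw [heq]
    exact update_mem_FP h' a (h a)

end ACCompile

/-! ### The compiled adversary for `acLang_bppCompiles` -/

namespace ACCompile

open _root_.Computability Literature.Computability.Complexity Literature.Computability.Cryptography
open Literature.Computability.Complexity.OracleAlg Literature.Computability.Complexity.Brick
  Literature.Computability.Complexity.Plumb Literature.Computability.Complexity.OracleCompose
  Literature.Computability.Complexity.HashBricks Literature.Computability.QuantumComplexity Polynomial

variable {ℓ : ℕ → ℕ}

/-! #### The announced queries: `⟨1ⁿ, ⟨1^{q|z|}, s⟩⟩` -/

/-- The query rewriting `d ⟨z, ⟨code as, s⟩⟩ = ⟨fst z, ⟨1^{q(|z|)}, s⟩⟩`: announce, with each query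
`s` of `M` on `z = ⟨1ⁿ, r⟩`, the level `1ⁿ` and the truncation bound `1^{q(|z|)}`. [folklore] -/
def dF (q : Polynomial ℕ) : List Bool → List Bool :=
  fanoutFn (fstF ∘ fstF) (fanoutFn (polyFn q ∘ fstF) (sndPow 1))

/-- Value of `dF`. [folklore] -/
@[simp] theorem dF_apply (q : Polynomial ℕ) (z c s : List Bool) :
    dF q (boolPair z (boolPair c s)) = boolPair (fstF z) (boolPair (ones (q.eval z.length)) s) := by
  simp [dF]

/-- `dF q ∈ FP`. [folklore] -/
theorem dF_mem_FP (q : Polynomial ℕ) : dF q ∈ FP :=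
  fanoutFn_mem_FP (comp_mem_FP fstF_mem_FP fstF_mem_FP)
    (fanoutFn_mem_FP (comp_mem_FP (polyFn_mem_FP q) fstF_mem_FP) (sndPow_mem_FP 1))

/-! #### The level tables as one string function -/

/-- The background tables as a string function on well-formed pairs:
`tblFn W ⟨u, x⟩ = levelValue W |u| x` (and the second component on other words). [folklore] -/
def tblFn (W : Tables ℓ) (w : List Bool) : List Bool :=
  if boolPair (fstF w) (sndF w) = w then levelValue W (fstF w).length (sndF w) else sndF w

/-- Value of `tblFn` on a pair. [folklore] -/
theorem tblFn_boolPair (W : Tables ℓ) (u x : List Bool) :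
    tblFn W (boolPair u x) = levelValue W u.length x := by
  simp [tblFn]

/-- A background that is the identity outside the finite set `S` of levels differs from the
second projection only on the finitely many well-formed pairs `⟨u, x⟩` with `|u| ∈ S`,
`|x| = ℓ |u|` — hence `tblFn W ∈ FP`. [folklore] -/
theorem tblFn_mem_FP (W : Tables ℓ) (S : Finset ℕ) (hS : ∀ m, m ∉ S → W m = id) : tblFn W ∈ FP := by
  classical
  -- the exceptional set
  let D : Finset (List Bool) := S.biUnion fun m =>
    ((Finset.univ : Finset (List.Vector Bool m)) ×ˢ (Finset.univ : Finset (List.Vector Bool (ℓ m)))).image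
      fun p => boolPair p.1.toList p.2.toList
  refine mem_FP_of_eqOn_compl_finset sndF_mem_FP D _ fun w hw => ?_
  unfold tblFn
  split_ifs with hwf
  · -- a well-formed pair off `D`: the level is an identity level or the length is off
    unfold levelValue
    split_ifs with hlen
    · by_cases hm : (fstF w).length ∈ S
      · exfalso
        apply hw
        refine Finset.mem_biUnion.2 ⟨(fstF w).length, hm, Finset.mem_image.2 ?_⟩
        exact ⟨(⟨fstF w, rfl⟩, ⟨sndF w, hlen⟩), by simp, hwf⟩
      · rw [hS _ hm]; rfl
    · rfl
  · rfl

/-! #### The one-query transducer answering an announced query -/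

/-- The argument `x` of the announced query `s = 1^m 0 1^j 0 x` (input `⟨u, ε⟩`, `u = ⟨1ⁿ, ⟨1^B, s⟩⟩`):
the ONE query to the table. [folklore] -/
def qryQ : List Bool → List Bool := afterZeroFn ∘ afterZeroFn ∘ sndPow 1 ∘ fstF

/-- `qryQ ∈ FP`. [folklore] -/
theorem qryQ_mem_FP : qryQ ∈ FP :=
  comp_mem_FP afterZeroFn_mem_FP (comp_mem_FP afterZeroFn_mem_FP (comp_mem_FP (sndPow_mem_FP 1) fstF_mem_FP))

section OutputMap

variable (W : Tables ℓ)

/-- Field `1ⁿ` of the record `⟨⟨1ⁿ, ⟨1^B, s⟩⟩, a⟩`. [folklore] -/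
def nU : List Bool → List Bool := fstF ∘ fstF
/-- Field `1^B`. [folklore] -/
def bU : List Bool → List Bool := nthF 1 ∘ fstF
/-- Field `s` (the query of `M`). [folklore] -/
def sU : List Bool → List Bool := sndPow 1 ∘ fstF
/-- Field `a` (the answer of the table). [folklore] -/
def aU : List Bool → List Bool := sndF
/-- `1^m` of `s = 1^m 0 1^j 0 x`. [folklore] -/
def mU : List Bool → List Bool := onesPrefixFn ∘ sU
/-- `1^j 0 x`. [folklore] -/
def r1U : List Bool → List Bool := afterZeroFn ∘ sU
/-- `1^j`. [folklore] -/
def jU : List Bool → List Bool := onesPrefixFn ∘ r1U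
/-- `x`. [folklore] -/
def xU : List Bool → List Bool := afterZeroFn ∘ r1U
/-- `[s is a header]`. [folklore] -/
def validU : List Bool → List Bool :=
  eqPairFn ∘ fanoutFn sU (concatFn ∘ fanoutFn mU (List.cons false ∘ concatFn ∘ fanoutFn jU (List.cons false ∘ xU)))
/-- `[|s| ≤ B]` (`s ↾ B = s`). [folklore] -/
def lenokU : List Bool → List Bool := eqPairFn ∘ fanoutFn (takeFn ∘ fanoutFn bU sU) sU
/-- `[m = n]`. [folklore] -/
def isLvlU : List Bool → List Bool := eqPairFn ∘ fanoutFn mU nU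
/-- The level value: at level `n` from the table's answer (`x` if empty), otherwise from the
background (`tblFn`). [folklore] -/
def valueU : List Bool → List Bool :=
  iteFn isLvlU (iteFn (isNilFn ∘ aU) xU aU) (tblFn W ∘ fanoutFn mU xU)
/-- **The output map** `G`: the one-bit answer `[ |s| ≤ B ∧ s is a header ∧ bit j of the value ]`.
[folklore] -/
def outU : List Bool → List Bool :=
  andFn validU (andFn lenokU (eqPairFn ∘ fanoutFn (bitAtFn ∘ fanoutFn jU (valueU W)) (fun _ => [true])))

/-- `outU W ∈ FP` for a finitely supported background. [folklore] -/
theorem outU_mem_FP (S : Finset ℕ) (hS : ∀ m, m ∉ S → W m = id) : outU W ∈ FP := by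
  have hsU : sU ∈ FP := comp_mem_FP (sndPow_mem_FP 1) fstF_mem_FP
  have hnU : nU ∈ FP := comp_mem_FP fstF_mem_FP fstF_mem_FP
  have hbU : bU ∈ FP := comp_mem_FP (nthF_mem_FP 1) fstF_mem_FP
  have hmU : mU ∈ FP := comp_mem_FP onesPrefixFn_mem_FP hsU
  have hr1U : r1U ∈ FP := comp_mem_FP afterZeroFn_mem_FP hsU
  have hjU : jU ∈ FP := comp_mem_FP onesPrefixFn_mem_FP hr1U
  have hxU : xU ∈ FP := comp_mem_FP afterZeroFn_mem_FP hr1U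
  have hvalid : validU ∈ FP :=
    comp_mem_FP eqPairFn_mem_FP (fanoutFn_mem_FP hsU (comp_mem_FP concatFn_mem_FP
      (fanoutFn_mem_FP hmU (comp_mem_FP (cons_mem_FP false) (comp_mem_FP concatFn_mem_FP
        (fanoutFn_mem_FP hjU (comp_mem_FP (cons_mem_FP false) hxU)))))))
  have hlenok : lenokU ∈ FP :=
    comp_mem_FP eqPairFn_mem_FP (fanoutFn_mem_FP (comp_mem_FP takeFn_mem_FP (fanoutFn_mem_FP hbU hsU)) hsU)
  have hisLvl : isLvlU ∈ FP := comp_mem_FP eqPairFn_mem_FP (fanoutFn_mem_FP hmU hnU)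
  have hvalue : valueU W ∈ FP :=
    iteFn_mem_FP hisLvl (iteFn_mem_FP (comp_mem_FP isNilFn_mem_FP sndF_mem_FP) hxU sndF_mem_FP)
      (comp_mem_FP (tblFn_mem_FP W S hS) (fanoutFn_mem_FP hmU hxU))
  exact andFn_mem_FP hvalid (andFn_mem_FP hlenok (comp_mem_FP eqPairFn_mem_FP
    (fanoutFn_mem_FP (comp_mem_FP bitAtFn_mem_FP (fanoutFn_mem_FP hjU hvalue)) (const_mem_FP _))))

end OutputMap

/-! #### Semantics of the transducer on an announced query -/

/-- The level-`n` value read off the table oracle: `g x` if `x` has the block length (`x` if the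
answer is empty), i.e. `levelValue (W[n ↦ g]) n x`. [folklore] -/
theorem levelValue_update_self (W : Tables ℓ) (n : ℕ) (g : Tbl ℓ n) (x : List Bool) :
    levelValue (Function.update W n g) n x =
      (if oracleOfTable g x = [] then x else oracleOfTable g x) := by
  unfold levelValue
  by_cases hx : x.length = ℓ n
  · rw [dif_pos hx, Function.update_self, oracleOfTable_apply_of_length_eq g hx]
    by_cases h0 : (g ⟨x, hx⟩).toList = []
    · rw [if_pos h0, h0]
      have : x.length = 0 := by rw [hx, ← (g ⟨x, hx⟩).toList_length, h0]; rfl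
      exact (List.length_eq_zero_iff.1 this).symm ▸ rfl
    · rw [if_neg h0]
  · rw [dif_neg hx, oracleOfTable_apply_of_length_ne g hx, if_pos rfl]

/-- `s ↾ B = s` iff `|s| ≤ B`. [folklore] -/
theorem take_eq_self_iff_le (s : List Bool) (B : ℕ) : s.take B = s ↔ s.length ≤ B := by
  constructor
  · intro h
    have := congrArg List.length h
    rw [List.length_take] at this
    omega
  · exact List.take_of_length_le

/-- **The transducer's answer to the announced query `⟨1ⁿ, ⟨1^B, s⟩⟩`** is the truncated oracle bit
`[ |s| ≤ B ∧ s ∈ acLang (W[n ↦ g]) ]` — read through one query `x` to the table (`qryQ`) when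
`s = 1^m 0 1^j 0 x`; a non-header is answered `0` and is not in `acLang`. [cite: AaronsonChen2017, Thm. 7.6 (proof, p. 30)] -/
theorem outU_announced (W : Tables ℓ) (n : ℕ) (g : Tbl ℓ n) (B : ℕ) (s : List Bool) :
    outU W (boolPair (boolPair (ones n) (boolPair (ones B) s))
      (oracleOfTable g (qryQ (boolPair (boolPair (ones n) (boolPair (ones B) s)) [])))) =
      Oracle.ofLanguage (truncLang (acLang (Function.update W n g)) B) s := by
  classical
  set u := boolPair (ones n) (boolPair (ones B) s) with hu
  set a := oracleOfTable g (qryQ (boolPair u [])) with ha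
  set w := boolPair u a with hw
  -- the parsed fields
  have hsU : sU w = s := by simp [sU, hw, hu]
  have hnU : nU w = ones n := by simp [nU, hw, hu]
  have hbU : bU w = ones B := by simp [bU, hw, hu]
  have haU : aU w = a := by simp [aU, hw]
  have hmU : mU w = ones (splitOnes s).1 := by simp [mU, Function.comp_apply, hsU, onesPrefixFn]
  have hr1U : r1U w = (splitOnes s).2 := by simp [r1U, Function.comp_apply, hsU, afterZeroFn]
  have hjU : jU w = ones (splitOnes (splitOnes s).2).1 := by
    simp [jU, Function.comp_apply, hr1U, onesPrefixFn]
  have hxU : xU w = (splitOnes (splitOnes s).2).2 := by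
    simp [xU, Function.comp_apply, hr1U, afterZeroFn]
  have hq : qryQ (boolPair u []) = (splitOnes (splitOnes s).2).2 := by
    simp [qryQ, hu, afterZeroFn]
  -- validity and length bits
  have hvalid : validU w = [decide (s = hdr (splitOnes s).1 (splitOnes (splitOnes s).2).1 (splitOnes (splitOnes s).2).2)] := by
    rw [validU, Function.comp_apply, fanoutFn_apply, hsU, Function.comp_apply, fanoutFn_apply, hmU,
      concatFn_boolPair, Function.comp_apply, Function.comp_apply, fanoutFn_apply, hjU, concatFn_boolPair,
      Function.comp_apply, hxU, eqPairFn_boolPair]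
    rfl
  have hlenok : lenokU w = [decide (s.length ≤ B)] := by
    rw [lenokU, Function.comp_apply, fanoutFn_apply, Function.comp_apply, fanoutFn_apply, hbU, hsU,
      takeFn_boolPair, eqPairFn_boolPair]
    rw [show (ones B).length = B by simp [ones]]
    simp only [take_eq_self_iff_le]
  -- split on validity
  by_cases hval : s = hdr (splitOnes s).1 (splitOnes (splitOnes s).2).1 (splitOnes (splitOnes s).2).2
  · -- a header `s = hdr m j x`
    set m := (splitOnes s).1 with hm
    set j := (splitOnes (splitOnes s).2).1 with hj
    set x := (splitOnes (splitOnes s).2).2 with hx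
    have hisLvl : isLvlU w = [decide (m = n)] := by
      rw [isLvlU, Function.comp_apply, fanoutFn_apply, hmU, hnU, eqPairFn_boolPair]
      simp [ones]
    have hvalue : valueU W w = levelValue (Function.update W n g) m x := by
      rw [valueU, iteFn_apply hisLvl]
      by_cases hmn : m = n
      · rw [if_pos (by simp [hmn]), iteFn_apply (b := decide (a = []))
          (by rw [Function.comp_apply, haU]; simp [isNilFn]), hxU, haU, hmn, levelValue_update_self, ha, hq]
        by_cases h0 : oracleOfTable g x = [] <;> simp [h0]
      · rw [if_neg (by simp [hmn]), Function.comp_apply, fanoutFn_apply, hmU, hxU, tblFn_boolPair]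
        rw [show (ones m).length = m by simp [ones], levelValue_update, if_neg hmn]
    have hbit : (eqPairFn ∘ fanoutFn (bitAtFn ∘ fanoutFn jU (valueU W)) fun _ => [true]) w =
        [(levelValue (Function.update W n g) m x).getD j false] := by
      rw [Function.comp_apply, fanoutFn_apply, Function.comp_apply, fanoutFn_apply, hjU, hvalue,
        bitAtFn_boolPair, eqPairFn_boolPair]
      rw [show (ones j).length = j by simp [ones], ACEval.decide_take_one_drop_eq]
    rw [outU, andFn_apply hvalid (andFn_apply hlenok hbit), PRelSigma.ofLanguage_eq_singleton]
    have hmem : s ∈ acLang (Function.update W n g) ↔ (levelValue (Function.update W n g) m x).getD j false = true := by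
      conv_lhs => rw [hval]
      exact hdr_mem_acLang _ m j x
    refine congrArg (fun b => [b]) ?_
    rw [decide_eq_true hval, Bool.true_and]
    by_cases hB : s.length ≤ B
    · rw [decide_eq_true hB, Bool.true_and]
      by_cases hb : (levelValue (Function.update W n g) m x).getD j false = true
      · rw [hb]
        exact ((Set.mem_iff_boolIndicator _ _).1 (show s ∈ truncLang _ B from ⟨hmem.2 hb, hB⟩)).symm
      · rw [Bool.not_eq_true] at hb
        rw [hb]
        refine ((Set.notMem_iff_boolIndicator _ _).1 ?_).symm
        intro h
        have h1 : s ∈ acLang (Function.update W n g) := h.1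
        rw [hmem.1 h1] at hb
        exact Bool.false_ne_true hb.symm
    · rw [decide_eq_false hB, Bool.false_and]
      refine ((Set.notMem_iff_boolIndicator _ _).1 ?_).symm
      intro h
      exact hB h.2
  · -- not a header: rejected, and not in `acLang`
    have hbit : ∃ b, (eqPairFn ∘ fanoutFn (bitAtFn ∘ fanoutFn jU (valueU W)) fun _ => [true]) w = [b] := by
      rw [Function.comp_apply, fanoutFn_apply, eqPairFn_boolPair]; exact ⟨_, rfl⟩
    obtain ⟨b, hb⟩ := hbit
    rw [outU, andFn_apply hvalid (andFn_apply hlenok hb), PRelSigma.ofLanguage_eq_singleton]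
    have hnot : s ∉ acLang (Function.update W n g) := by
      rintro ⟨m, j, x, rfl, -⟩
      apply hval
      simp [hdr]
    have hind : (truncLang (acLang (Function.update W n g)) B).boolIndicator s = false :=
      (Set.notMem_iff_boolIndicator _ _).1 (fun h => hnot h.1)
    rw [hind]
    simp [hval]

/-! #### The transducer and the intermediate oracle it computes -/

/-- The one-query transducer `N` of the compiled adversary. [folklore] -/
def transN (W : Tables ℓ) : OracleAlg (List Bool) := ttFnAlg qryQ 1 (outU W)

/-- The intermediate oracle COMPUTED by `N` relative to the table `g`: on every word `u`, the
transducer's output. [folklore] -/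
def fN (W : Tables ℓ) {n : ℕ} (g : Tbl ℓ n) : Oracle := fun u =>
  outU W (boolPair u (oracleOfTable g (qryQ (boolPair u []))))

/-- `N` computes `fN` within `|u| + 2` rounds, with its one query no longer than `u`. [folklore] -/
theorem transN_computes (W : Tables ℓ) {n : ℕ} (g : Tbl ℓ n) (u : List Bool) :
    (transN W).run (oracleOfTable g) ((X + 2 : Polynomial ℕ).eval u.length) u = some (fN W g u) ∧
      ∀ y ∈ (transN W).queries (oracleOfTable g) ((X + 2 : Polynomial ℕ).eval u.length) u,
        y.length ≤ (X + 2 : Polynomial ℕ).eval u.length := by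
  have hk : 2 ≤ (X + 2 : Polynomial ℕ).eval u.length := by simp
  obtain ⟨hrun, hqs⟩ := run_ttFnAlg_one qryQ (outU W) (oracleOfTable g) u hk
  refine ⟨hrun, fun y hy => ?_⟩
  rw [transN, hqs, List.mem_singleton] at hy
  subst hy
  have h1 : (qryQ (boolPair u [])).length ≤ u.length := by
    simp only [qryQ, Function.comp_apply, fstF_boolPair]
    exact (length_afterZeroFn_le _).trans ((length_afterZeroFn_le _).trans (length_sndPow_le 1 u))
  exact h1.trans (by simp)

/-- `N` is polynomial-time. [folklore] -/
theorem isPolyTime_transN (W : Tables ℓ) (S : Finset ℕ) (hS : ∀ m, m ∉ S → W m = id) :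
    (transN W).IsPolyTime (encodingList Bool) :=
  isPolyTime_ttFnAlg qryQ_mem_FP (outU_mem_FP W S hS)

/-! #### The `M`-side: announced queries, clocked -/

/-- The clocked, query-announcing version of the `P^O` machine `M`. [folklore] -/
def annM (M : OracleAlg Bool) (q : Polynomial ℕ) : OracleAlg Bool := (M.mapQuery (dF q)).clock q false

/-- `annM M q` is polynomial-time when `M` is. [folklore] -/
theorem isPolyTime_annM {M : OracleAlg Bool} (hM : M.IsPolyTime encodingBoolBool) (q : Polynomial ℕ) :
    (annM M q).IsPolyTime encodingBoolBool :=
  isPolyTime_clock encodingBoolBool (isPolyTime_mapQuery encodingBoolBool hM (dF_mem_FP q)) q false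

/-- The truncated oracle of the printed `P^O` semantics at the input `z` (`baseLang`). [folklore] -/
def truncOr (W : Tables ℓ) {n : ℕ} (g : Tbl ℓ n) (q : Polynomial ℕ) (z : List Bool) : Oracle :=
  Oracle.ofLanguage (truncLang (acLang (Function.update W n g)) (q.eval z.length))

/-- Along the run of `M` on an input `z` with first component `1ⁿ` against the truncated oracle, the
intermediate oracle `fN` answers every announced query as the truncated oracle answers the query
(`MapAgree`). [cite: AaronsonChen2017, Thm. 7.6 (proof, p. 30)] -/
theorem mapAgree_fN (W : Tables ℓ) {n : ℕ} (g : Tbl ℓ n) (M : OracleAlg Bool) (q : Polynomial ℕ) {z : List Bool}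
    (hz : fstF z = ones n) : MapAgree M (dF q) (fN W g) (truncOr W g q z) z := by
  intro i s _ _
  rw [dF_apply, hz, fN, truncOr]
  exact outU_announced W n g _ s

/-- The output of the compiled machine on `z`: the verdict of `M` against the truncated oracle
within `q|z|` rounds, `0` if there is none. [folklore] -/
def gOut (W : Tables ℓ) {n : ℕ} (g : Tbl ℓ n) (M : OracleAlg Bool) (q : Polynomial ℕ) (z : List Bool) : Bool :=
  (M.run (truncOr W g q z) (q.eval z.length) z).getD false

/-- `gOut = 1` iff `z ∈ baseLang M q (acLang (W[n ↦ g]))`. [folklore] -/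
theorem gOut_eq_true_iff (W : Tables ℓ) {n : ℕ} (g : Tbl ℓ n) (M : OracleAlg Bool) (q : Polynomial ℕ)
    (z : List Bool) : gOut W g M q z = true ↔ z ∈ baseLang M q (acLang (Function.update W n g)) := by
  change (M.run (truncOr W g q z) (q.eval z.length) z).getD false = true ↔
    M.run (truncOr W g q z) (q.eval z.length) z = some true
  cases M.run (truncOr W g q z) (q.eval z.length) z with
  | none => simp
  | some b => cases b <;> simp

/-- **The output of the `M`-side machine** on an input `z` with first component `1ⁿ`, within
`q|z| + 1` rounds and against `fN`: the verdict `gOut`. [cite: AaronsonChen2017, Thm. 7.6 (proof, p. 30)] -/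
theorem run_annM (W : Tables ℓ) {n : ℕ} (g : Tbl ℓ n) (M : OracleAlg Bool) (q : Polynomial ℕ) {z : List Bool}
    (hz : fstF z = ones n) :
    (annM M q).run (fN W g) (q.eval z.length + 1) z = some (gOut W g M q z) := by
  rw [annM, run_clock_eq, run_mapQuery _ _ _ _ _ (mapAgree_fN W g M q hz)]
  rfl

/-- **Query-length bound of the `M`-side machine** against `fN` (one-symbol answers): with the
output-length bound `RM` of the step function of `M`, every query within `q|z| + 1` rounds has
length `≤ 2|z| + 2 q|z| + 4 + RM (2|z| + 6 q|z| + 10)`. [folklore] -/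
theorem length_query_annM (W : Tables ℓ) {n : ℕ} (g : Tbl ℓ n) {M : OracleAlg Bool} {RM : Polynomial ℕ}
    (hRM : ∀ (x : List Bool) (ans : List (List Bool)),
      (((encodingList Bool).sumBool encodingBoolBool).encode (M.step x ans)).length ≤
        RM.eval (boolPair x ((encodingList Bool).listBool.encode ans)).length)
    (q : Polynomial ℕ) {z : List Bool} (hz : fstF z = ones n) {y : List Bool}
    (hy : y ∈ (annM M q).queries (fN W g) (q.eval z.length + 1) z) :
    y.length ≤ (2 * X + 2 * q + 4 + RM.comp (2 * X + 6 * q + 10)).eval z.length := by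
  have hy0 : y ∈ ((M.mapQuery (dF q)).clock q false).queries (fN W g) (q.eval z.length + 1) z := by
    simpa only [annM] using hy
  have hy' := queries_clock_subset (M.mapQuery (dF q)) q false (fN W g) z (q.eval z.length + 1) hy0
  have hy'' : y ∈ (M.mapQuery (dF q)).queriesAux (fN W g) z (q.eval z.length + 1)
      (PRelSigma.trans M (truncOr W g q z) z 0) := by
    rw [PRelSigma.trans_zero]; exact hy'
  have h3 := queriesAux_mapQuery_lt M (dF q) (fN W g) (truncOr W g q z) z
    (mapAgree_fN W g M q hz) (q.eval z.length + 1) 0 y (fun _ h => absurd h (Nat.not_lt_zero _)) hy''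
  obtain ⟨i, s, hi, hs, hyeq⟩ := h3
  -- the query of `M` at round `i ≤ q|z|`
  have hlen := hRM z (PRelSigma.trans M (truncOr W g q z) z i)
  rw [hs] at hlen
  have henc : (((encodingList Bool).sumBool encodingBoolBool).encode (Sum.inl s : List Bool ⊕ Bool)).length =
      s.length + 1 := by
    simp [Encoding.sumBool, encodingList]
  have htr : ((encodingList Bool).listBool.encode (PRelSigma.trans M (truncOr W g q z) z i)).length = 6 * i + 2 :=
    length_listBool_trans_ofLanguage M _ z i
  rw [henc, length_boolPair, htr] at hlen
  have hRM' : s.length + 1 ≤ RM.eval (2 * z.length + 6 * q.eval z.length + 10) :=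
    hlen.trans (TM2Iter.eval_mono RM (by omega))
  have hnz : (fstF z).length ≤ z.length := by have := length_fstF_sndF_le z; omega
  rw [hyeq, dF_apply, length_boolPair, length_boolPair]
  simp only [ones, List.length_replicate, Polynomial.eval_add, Polynomial.eval_mul, Polynomial.eval_ofNat,
    Polynomial.eval_X, Polynomial.eval_comp]
  omega

/-- The polynomial of the uniform composition for the `M`-side machine:
`qM = q + 1 + (2X + 2q + 4 + RM ∘ (2X + 6q + 10))`. [folklore] -/
def qMPoly (q RM : Polynomial ℕ) : Polynomial ℕ := q + 1 + (2 * X + 2 * q + 4 + RM.comp (2 * X + 6 * q + 10))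

/-- The run hypothesis of the uniform composition for the `M`-side machine. [folklore] -/
theorem annM_runs (W : Tables ℓ) {n : ℕ} (g : Tbl ℓ n) {M : OracleAlg Bool} {RM : Polynomial ℕ}
    (hRM : ∀ (x : List Bool) (ans : List (List Bool)),
      (((encodingList Bool).sumBool encodingBoolBool).encode (M.step x ans)).length ≤
        RM.eval (boolPair x ((encodingList Bool).listBool.encode ans)).length)
    (q : Polynomial ℕ) {z : List Bool} (hz : fstF z = ones n) :
    (annM M q).run (fN W g) ((qMPoly q RM).eval z.length) z = some (gOut W g M q z) ∧
      ∀ y ∈ (annM M q).queries (fN W g) ((qMPoly q RM).eval z.length) z,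
        y.length ≤ (qMPoly q RM).eval z.length := by
  have hle : q.eval z.length + 1 ≤ (qMPoly q RM).eval z.length := by simp [qMPoly]
  have hrun := run_annM W g M q hz
  refine ⟨run_mono _ _ z hle hrun, fun y hy => ?_⟩
  have hq : (annM M q).queries (fN W g) ((qMPoly q RM).eval z.length) z =
      (annM M q).queries (fN W g) (q.eval z.length + 1) z :=
    queries_eq_of_run_eq_some _ _ z hle hrun
  rw [hq] at hy
  refine (length_query_annM W g hRM q hz hy).trans ?_
  simp [qMPoly]

/-! ### Assembly: the leaf `acLang_bppCompiles` -/

/-- The output law of an oracle adversary as a `uniformProb` over its coins. [cite: AroraBarak2009, Def. 7.1] -/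
theorem outputPMF_toReal_eq_uniformProb (𝒜 : OracleAdversary Bool) (O : Oracle) (x : List Bool) :
    (𝒜.outputPMF O x (some true)).toReal =
      uniformProb (𝒜.coins.eval x.length)
        {r | 𝒜.alg.run O (𝒜.fuel.eval x.length) (boolPair x r) = some true} := by
  classical
  rw [outputPMF_toReal_eq_card, uniformProb_eq_cnt_div, cnt]
  simp only [Set.mem_setOf_eq]

/-- `|1ⁿ| = n` for Mathlib's unary numerals (a `private` copy of the tree's
`Literature.Computability.Cryptography.length_unaryEncodeNat` / `…MetaComplexity…length_unaryEncodeNat`,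
neither in this file's import closure). [folklore] -/
private theorem length_unaryEncodeNat_eq (n : ℕ) : (unaryEncodeNat n).length = n := by
  rw [OracleCompose.unaryEncodeNat_eq_replicate, List.length_replicate]

/-- **Discharge of the compilation leaf `acLang_bppCompiles`** (Aaronson–Chen 2017, proof of
Thm. 7.6: a `BPP^O` machine probing level `n` of the oracle is a probabilistic polynomial-time
adversary in the PRF game of that level). The adversary is the composite
`OracleComposition.compose (annM M q) (transN W) …` with coins `p` and a polynomial round budget: on
`⟨1ⁿ, r⟩` it runs `M` on `⟨1ⁿ, r⟩` clocked at `q` rounds, announcing `⟨1ⁿ, ⟨1^{q|z|}, s⟩⟩` with each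
query `s`, each announced query being answered by the one-query transducer from the table oracle;
by `run_annM`/`gOut_eq_true_iff` it accepts exactly when `⟨1ⁿ, r⟩ ∈ baseLang M q (acLang (W[n ↦ g]))`,
so its acceptance probability is `accAt M q p (acLang (W[n ↦ g])) n`.
[cite: AaronsonChen2017, Thm. 7.6 (proof, p. 30)] [cite: AroraBarak2009, Def. 7.3 with §3.4] -/
theorem acLang_bppCompiles_holds : acLang_bppCompiles := by
  intro ℓ M hM q p W S hS
  obtain ⟨RM, hRM⟩ := hM.exists_length_le
  obtain ⟨C, hC, K, hspec⟩ := exists_compose_uniform (isPolyTime_annM hM q) (isPolyTime_transN W S hS)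
    (qMPoly q RM) (X + 2)
  refine ⟨⟨C, p, K.comp (2 * X + 2 + p)⟩, hC, fun n g => ?_⟩
  rw [OracleAdversary.acceptProb, outputPMF_toReal_eq_uniformProb, accAt, length_unaryEncodeNat_eq]
  rw [uniformProb_eq_cnt_div, uniformProb_eq_cnt_div, cnt_congr (fun r hr => ?_)]
  -- one coin string `r` of length `p(n)`: the composite's verdict is membership in `baseLang`
  simp only [Set.mem_setOf_eq]
  have hz1 : boolPair (unaryEncodeNat n) r = boolPair (List.replicate n true) r := by
    rw [OracleCompose.unaryEncodeNat_eq_replicate]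
  have hz : fstF (boolPair (unaryEncodeNat n) r) = ones n := by
    rw [fstF_boolPair, OracleCompose.unaryEncodeNat_eq_replicate]
  have hlen : (boolPair (unaryEncodeNat n) r).length = (2 * X + 2 + p).eval n := by
    rw [length_boolPair, length_unaryEncodeNat_eq, hr]
    simp
  have hrun := (hspec (oracleOfTable g) (fN W g) (gOut W g M q) (transN_computes W g)
    (boolPair (unaryEncodeNat n) r) (annM_runs W g hRM q hz)).1
  rw [hlen, ← Polynomial.eval_comp] at hrun
  change C.run (oracleOfTable g) ((K.comp (2 * X + 2 + p)).eval n) (boolPair (unaryEncodeNat n) r) = some true ↔ _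
  rw [hrun, Option.some.injEq, gOut_eq_true_iff, hz1]

end ACCompile

open Literature.Computability.Complexity Literature.Computability.Cryptography

/-- **The compilation leaf of Thm. 7.6, discharged** (re-export at the directory namespace).
[cite: AaronsonChen2017, Thm. 7.6 (proof, p. 30)] -/
theorem acLang_bppCompiles_holds : acLang_bppCompiles := ACCompile.acLang_bppCompiles_holds

/-- Hence `aaronsonChen2017_thm76_of_prp` from the two remaining leaves — `PRF^mod` security
(Lemma 7.5 (1), second half) and the quantum machine (Lemma 7.5 (2)–(3)) — the switching lemma, the
`P/poly` leaf and the compilation leaf being discharged (`aaronsonChen2017_lem75_prp_isPRF_holds`,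
`aaronsonChen2017_thm76_ppoly_holds`, `acLang_bppCompiles_holds`).
[cite: AaronsonChen2017, Thm. 7.6 (proof, p. 30)] -/
theorem aaronsonChen2017_thm76_of_prp_of_leaves₂ (h₂ : aaronsonChen2017_lem75_prfMod_isPRF)
    (hq : aaronsonChen2017_lem75_quantum) : aaronsonChen2017_thm76_of_prp :=
  aaronsonChen2017_thm76_of_prp_of_leaves aaronsonChen2017_lem75_prp_isPRF_holds h₂ hq
    acLang_bppCompiles_holds aaronsonChen2017_thm76_ppoly_holds

/-- **Thm. 7.6 from HILL, GGM, Luby–Rackoff and the two remaining leaves.**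
[cite: AaronsonChen2017, Thm. 7.6, Lemma 7.4, Lemma 7.5] -/
theorem aaronsonChen2017_thm76_of_leaves₂ (hHILL : PRGExist_iff_OWFExist) (hGGM : PRFExist_of_PRGExist)
    (hLR : PRPExist_of_PRFExist) (h₂ : aaronsonChen2017_lem75_prfMod_isPRF)
    (hq : aaronsonChen2017_lem75_quantum) : aaronsonChen2017_thm76 :=
  aaronsonChen2017_thm76_of_parts' hHILL hGGM hLR (aaronsonChen2017_thm76_of_prp_of_leaves₂ h₂ hq)

end Literature.Barriers.QuantumAdvantage

end
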